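import Literature.NumberTheory.LFunctions.WeilExplicit
import Literature.NumberTheory.LFunctions.WeilExplicitProofs
import Literature.NumberTheory.LFunctions.WeilExplicitContinuous
import HarnessLib

/-!
# `SignConeFarField` — negative lemmas, part 1: the bump autocorrelation `Γ = b ⋆ b` and the witness profile

Refuter (crux disprover) support for the crux `stmt-RiemannHypothesis-16305`
(`Summit.RiemannHypothesis.RiemannHypothesis.Theses.SignCone.SignConeFarField`): the real autocorrelation
`Γ(t) = ∫ b(u) b(u - t) du` of the smooth bump `b = WeilContinuous.bump 19` of radius `1/20`
(`Γ ≥ 0`, `Γ` even, smooth, `supp Γ ⊆ [-1/10, 1/10]`, `Γ(0) = ∫ b² > 0`, `∫ Γ > 0`, and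
`b ⋆ b̃ = Γ` as complex functions), and the witness profile `f₀(t) = Γ(t - 7/50) + Γ(t + 7/50)` (two
positive bumps at `±7/50`, NOTHING at the origin: `f₀ ≥ 0`, even, `f₀(0) = 0`, `supp f₀ ⊆ ±[1/25, 6/25]`;
`F₀ = f₀` is a Weil test supported in `[-2, 2]`). Used by `Negative/OriginDominates.lean`
(`signConeFarField_false_without_PD_nonneg`: without positive-definiteness the far-field sign-cone
inequality fails even for hermitian, everywhere non-negative tests, because `Re W_ar(F₀) < 0 = -F₀(0)`).
-/

set_option linter.dupNamespace false

noncomputable section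

open scoped BigOperators ComplexConjugate
open Complex MeasureTheory Set Filter

namespace Summit.RiemannHypothesis.RiemannHypothesis.Theorems.SignConeFarField.Negative

open Literature.NumberTheory.LFunctions

/-! ## The bump of radius `1/20` and its real autocorrelation `Γ` -/

/-- `rOut (bump 19) = 1/20`. [folklore] -/
theorem bump19_rOut : (WeilContinuous.bump 19).rOut = 1 / 20 := by
  rw [WeilContinuous.bump_rOut]
  norm_num

/-- `b(x) = 0` for `|x| ≥ 1/20`. [folklore] -/
theorem bump19_eq_zero {x : ℝ} (hx : 1 / 20 ≤ |x|) : (WeilContinuous.bump 19) x = 0 := by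
  apply (WeilContinuous.bump 19).zero_of_le_dist
  rwa [bump19_rOut, Real.dist_eq, sub_zero]

/-- `b(0) = 1`. [folklore] -/
theorem bump19_zero : (WeilContinuous.bump 19) 0 = 1 :=
  (WeilContinuous.bump 19).one_of_mem_closedBall
    (Metric.mem_closedBall_self (WeilContinuous.bump 19).rIn_pos.le)

/-- The bump as a complex Weil test function. [folklore] -/
theorem isWeilTest_bump19 : IsWeilTest (fun u : ℝ => (((WeilContinuous.bump 19) u : ℝ) : ℂ)) :=
  ⟨Complex.ofRealCLM.contDiff.comp (WeilContinuous.bump 19).contDiff,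
   (WeilContinuous.bump 19).hasCompactSupport.comp_left (g := fun r : ℝ => (r : ℂ)) Complex.ofReal_zero⟩

/-- The real autocorrelation `Γ(t) = ∫ b(u) b(u - t) du` of the bump. [folklore] -/
def gam (t : ℝ) : ℝ := ∫ u : ℝ, (WeilContinuous.bump 19) u * (WeilContinuous.bump 19) (u - t)

/-- `b ⋆ b̃ = Γ` (as a complex function). [folklore] -/
theorem weilConv_bump19_apply (t : ℝ) :
    weilConv (fun u : ℝ => (((WeilContinuous.bump 19) u : ℝ) : ℂ))
        (weilReflect (fun u : ℝ => (((WeilContinuous.bump 19) u : ℝ) : ℂ))) t = ((gam t : ℝ) : ℂ) := by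
  rw [gam, weilConv_apply, ← integral_complex_ofReal]
  refine integral_congr_ae (Eventually.of_forall fun u => ?_)
  simp only [weilReflect, neg_sub, Complex.conj_ofReal, Complex.ofReal_mul]

/-- `Γ ≥ 0`. [folklore] -/
theorem gam_nonneg (t : ℝ) : 0 ≤ gam t :=
  integral_nonneg fun _ => mul_nonneg (WeilContinuous.bump 19).nonneg (WeilContinuous.bump 19).nonneg

/-- `Γ(t) = 0` for `|t| ≥ 1/10` (the bumps `b(u)`, `b(u - t)` have disjoint supports). [folklore] -/
theorem gam_eq_zero {t : ℝ} (ht : 1 / 10 ≤ |t|) : gam t = 0 := by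
  have h : ∀ u : ℝ, (WeilContinuous.bump 19) u * (WeilContinuous.bump 19) (u - t) = 0 := by
    intro u
    by_cases hu : 1 / 20 ≤ |u|
    · rw [bump19_eq_zero hu, zero_mul]
    · push Not at hu
      have hut : 1 / 20 ≤ |u - t| := by
        have h1 : |t| - |u| ≤ |u - t| := by
          have := abs_sub_abs_le_abs_sub t u
          rwa [abs_sub_comm] at this
        linarith
      rw [bump19_eq_zero hut, mul_zero]
  simp [gam, h]

/-- `Γ(0) = ∫ b² > 0`. [folklore] -/
theorem gam_zero_pos : 0 < gam 0 := by
  simp only [gam, sub_zero]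
  have hc : Continuous fun u : ℝ => (WeilContinuous.bump 19) u * (WeilContinuous.bump 19) u :=
    (WeilContinuous.bump 19).continuous.mul (WeilContinuous.bump 19).continuous
  have hsupp : HasCompactSupport fun u : ℝ => (WeilContinuous.bump 19) u * (WeilContinuous.bump 19) u :=
    (WeilContinuous.bump 19).hasCompactSupport.mul_left
  refine integral_pos_of_integrable_nonneg_nonzero (x := 0) hc (hc.integrable_of_hasCompactSupport hsupp)
    (fun u => mul_nonneg (WeilContinuous.bump 19).nonneg (WeilContinuous.bump 19).nonneg) ?_
  simp [bump19_zero]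

/-- `Γ` is smooth (real part of the smooth kernel `b ⋆ b̃`). [folklore] -/
theorem contDiff_gam : ContDiff ℝ ((⊤ : ℕ∞) : WithTop ℕ∞) gam := by
  have hG := (isWeilTest_bump19.weilConv isWeilTest_bump19.weilReflect).1
  have e : gam = fun t => Complex.reCLM (weilConv (fun u : ℝ => (((WeilContinuous.bump 19) u : ℝ) : ℂ))
      (weilReflect (fun u : ℝ => (((WeilContinuous.bump 19) u : ℝ) : ℂ))) t) := by
    funext t
    rw [Complex.reCLM_apply, weilConv_bump19_apply, Complex.ofReal_re]
  rw [e]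
  exact Complex.reCLM.contDiff.comp hG

/-- `Γ` is continuous. [folklore] -/
theorem continuous_gam : Continuous gam :=
  contDiff_gam.continuous

/-- `Γ` is even (`b ⋆ b̃` is hermitian and real). [folklore] -/
theorem gam_neg (t : ℝ) : gam (-t) = gam t := by
  have h := conj_weilConv_weilReflect_neg (fun u : ℝ => (((WeilContinuous.bump 19) u : ℝ) : ℂ)) t
  rw [weilConv_bump19_apply, weilConv_bump19_apply, Complex.conj_ofReal] at h
  exact_mod_cast h

/-- `Γ` has compact support. [folklore] -/
theorem hasCompactSupport_gam : HasCompactSupport gam := by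
  refine HasCompactSupport.intro (isCompact_Icc : IsCompact (Icc (-(1 / 10 : ℝ)) (1 / 10))) fun x hx => ?_
  refine gam_eq_zero ?_
  rw [mem_Icc, not_and_or, not_le, not_le] at hx
  rcases hx with h | h
  · rw [abs_of_neg (by linarith)]
    linarith
  · rw [abs_of_pos (by linarith)]
    linarith

/-- `∫ Γ > 0`. [folklore] -/
theorem integral_gam_pos : 0 < ∫ t : ℝ, gam t :=
  integral_pos_of_integrable_nonneg_nonzero (x := 0) continuous_gam
    (continuous_gam.integrable_of_hasCompactSupport hasCompactSupport_gam) (fun t => gam_nonneg t)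
    gam_zero_pos.ne'

/-! ## The witness profile `f₀(t) = Γ(t - 7/50) + Γ(t + 7/50)` -/

/-- The real profile of the witness: two copies of `Γ` centred at `±7/50`. [folklore] -/
def f0 (t : ℝ) : ℝ := gam (t - 7 / 50) + gam (t + 7 / 50)

/-- `f₀ ≥ 0`. [folklore] -/
theorem f0_nonneg (t : ℝ) : 0 ≤ f0 t := add_nonneg (gam_nonneg _) (gam_nonneg _)

/-- `f₀` is even. [folklore] -/
theorem f0_neg (t : ℝ) : f0 (-t) = f0 t := by
  simp only [f0]
  rw [show -t - 7 / 50 = -(t + 7 / 50) by ring, show -t + 7 / 50 = -(t - 7 / 50) by ring, gam_neg, gam_neg,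
    add_comm]

/-- The right copy vanishes for `t ≤ 1/25`. [folklore] -/
theorem gam_shift_eq_zero_of_le {t : ℝ} (ht : t ≤ 1 / 25) : gam (t - 7 / 50) = 0 := by
  refine gam_eq_zero ?_
  rw [abs_of_nonpos (by linarith)]
  linarith

/-- The right copy vanishes for `t ≥ 6/25`. [folklore] -/
theorem gam_shift_eq_zero_of_ge {t : ℝ} (ht : 6 / 25 ≤ t) : gam (t - 7 / 50) = 0 := by
  refine gam_eq_zero ?_
  rw [abs_of_nonneg (by linarith)]
  linarith

/-- The left copy vanishes for `t ≥ -1/25`. [folklore] -/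
theorem gam_shift'_eq_zero_of_ge {t : ℝ} (ht : -(1 / 25) ≤ t) : gam (t + 7 / 50) = 0 := by
  refine gam_eq_zero ?_
  rw [abs_of_nonneg (by linarith)]
  linarith

/-- `f₀(t) = 0` for `|t| ≤ 1/25`: NOTHING at the origin. [folklore] -/
theorem f0_eq_zero_of_abs_le {t : ℝ} (ht : |t| ≤ 1 / 25) : f0 t = 0 := by
  rw [abs_le] at ht
  rw [f0, gam_shift_eq_zero_of_le ht.2, gam_shift'_eq_zero_of_ge ht.1, add_zero]

/-- `f₀(0) = 0`. [folklore] -/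
theorem f0_zero : f0 0 = 0 := f0_eq_zero_of_abs_le (by norm_num)

/-- `f₀(t) = 0` for `|t| ≥ 6/25`. [folklore] -/
theorem f0_eq_zero_of_le_abs {t : ℝ} (ht : 6 / 25 ≤ |t|) : f0 t = 0 := by
  rcases le_abs'.1 ht with h | h
  · have h' : f0 (-t) = 0 := by
      rw [f0, gam_shift_eq_zero_of_ge (by linarith), gam_shift'_eq_zero_of_ge (by linarith), add_zero]
    rwa [f0_neg] at h'
  · rw [f0, gam_shift_eq_zero_of_ge h, gam_shift'_eq_zero_of_ge (by linarith), add_zero]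

/-- For `t > 0` only the right copy is seen: `f₀(t) = Γ(t - 7/50)`. [folklore] -/
theorem f0_of_pos {t : ℝ} (ht : 0 < t) : f0 t = gam (t - 7 / 50) := by
  rw [f0, gam_shift'_eq_zero_of_ge (by linarith), add_zero]

/-- The witness `F₀ = f₀` (as a complex function) is a Weil test function. [folklore] -/
theorem isWeilTest_witness : IsWeilTest (fun t : ℝ => ((f0 t : ℝ) : ℂ)) := by
  constructor
  · have h1 : ContDiff ℝ ((⊤ : ℕ∞) : WithTop ℕ∞) fun t : ℝ => gam (t - 7 / 50) :=
      contDiff_gam.comp (contDiff_id.sub contDiff_const)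
    have h2 : ContDiff ℝ ((⊤ : ℕ∞) : WithTop ℕ∞) fun t : ℝ => gam (t + 7 / 50) :=
      contDiff_gam.comp (contDiff_id.add contDiff_const)
    exact Complex.ofRealCLM.contDiff.comp (h1.add h2)
  · refine HasCompactSupport.intro (isCompact_Icc : IsCompact (Icc (-(1 / 4 : ℝ)) (1 / 4))) fun x hx => ?_
    rw [mem_Icc, not_and_or, not_le, not_le] at hx
    have h0 : f0 x = 0 := by
      refine f0_eq_zero_of_le_abs ?_
      rcases hx with h | h
      · rw [abs_of_neg (by linarith)]
        linarith
      · rw [abs_of_pos (by linarith)]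
        linarith
    simp [h0]

/-- `tsupport F₀ ⊆ [-2, 2]` (indeed `⊆ [-1/4, 1/4]`). [folklore] -/
theorem tsupport_witness_subset :
    tsupport (fun t : ℝ => ((f0 t : ℝ) : ℂ)) ⊆ Icc (-(2 * (1 : ℝ))) (2 * 1) := by
  refine closure_minimal (fun x hx => ?_) isClosed_Icc
  rw [Function.mem_support] at hx
  by_contra h
  rw [mem_Icc, not_and_or, not_le, not_le] at h
  refine hx ?_
  have h0 : f0 x = 0 := by
    refine f0_eq_zero_of_le_abs ?_
    rcases h with h | h
    · rw [abs_of_neg (by linarith)]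
      linarith
    · rw [abs_of_pos (by linarith)]
      linarith
  simp [h0]

end Summit.RiemannHypothesis.RiemannHypothesis.Theorems.SignConeFarField.Negative

end
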